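import Literature.Computability.AlgebraicComplexity.FlipGraphSymmetryNormalForm
import Literature.Computability.AlgebraicComplexity.FlipGraphLadermanIsolatedKM
import Literature.Computability.AlgebraicComplexity.SchemeSymmetryGroupOrderF2
import Mathlib.LinearAlgebra.Matrix.GeneralLinearGroup.Card
import HarnessLib

/-!
# The order of the symmetry group over `ℤ₂`: `|G| = 6 · |GL_n(ℤ₂)|³`, i.e. `1296` for `2 × 2` and `168³ · 6 = 28 449 792` for `3 × 3` (HKS 2021 §5; KM 2023 §2)

Topic `Literature/Computability/AlgebraicComplexity`. Sources: M. J. H. Heule, M. Kauers, M. Seidl,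
*New ways to multiply 3 × 3-matrices*, J. Symbolic Comput. 104 (2021) 899–916 = arXiv:1905.10192
(HKS), §5: "even for `K = ℤ₂`, the group `G` has `168³ · 6 = 28 449 792` elements"; M. Kauers,
J. Moosbauer, *Flip Graphs for Matrix Multiplication*, ISSAC 2023 (KM), §2 (the symmetry group `G`
generated by the sandwiches, the cyclic shift and the transposition).

## What is typed (everything PROVED; no named facts)

`G` is the tree's `FlipGraph.InSymmetryGroup` (`FlipGraphEquivariance.lean`: the symmetries of
`⟨n,n,n⟩` generated by `Symmetry.sandwich P Q R`, `Symmetry.cycleSq`, `Symmetry.transposeSq` under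
composition and inverses), read as a set of MAPS of the tensor space (`GMaps K n`: two words of
generators acting identically are the same group element — the group HKS/KM count). The tree's
normal form (`FlipGraphSymmetryNormalForm.lean`: every `g ∈ G` acts as `σ_k ∘ (P,Q,R)` for a word
`k < 6` and invertible `P, Q, R` — the surjection `S₃ × GL_n(K)³ ↠ G`) is complemented here by the
INJECTIVITY of that parametrisation over `ℤ₂` (`n ≥ 2`):

* `nfMap_injective`: `σ_k ∘ (P,Q,R) = σ_{k'} ∘ (P',Q',R')` as maps forces `k = k'` (the word is
  detected by which slot of the image of `z ⊗ x ⊗ y` moves when `x`, resp. `y`, is varied; factors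
  of a non-zero rank-one tensor over `ℤ₂` are unique, `triad_factors_eq_of_two`) and then
  `P = P'`, `Q = Q'`, `R = R'` (Kronecker products of non-zero `0/1`-matrices determine their
  factors, `kronecker_cancel`); over a larger field the kernel would be the scalar triples;
* `card_GMaps : Nat.card (GMaps (ZMod 2) n) = 6 * Nat.card (GL (Fin n) (ZMod 2)) ^ 3` (`2 ≤ n`);
* **`heuleKauersSeidl2021_card_G_333 : Nat.card (GMaps (ZMod 2) 3) = 28449792`** (`= 168³ · 6`,
  with `|GL₃(ℤ₂)| = 168` = `card_GL_fin_three_zmod_two` of `SchemeSymmetryGroupOrderF2.lean`) and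
  `card_G_222 : Nat.card (GMaps (ZMod 2) 2) = 1296` (`= 6³ · 6`, the order used for `(2,2,2)`);
* `card_GMaps_three_eq_card_tuples`: the bridge to the tree's SET-LEVEL count
  `heuleKauersSeidl2021_symmetry_group_card` (`SchemeSymmetryGroupOrderF2.lean`:
  `|GL₃(ℤ₂)³ × S₃| = 28 449 792`, the order of the abstract group `GL₃(ℤ₂)³ ⋊ S₃`) — what is NEW in
  this file is that the ACTION on the tensor space is faithful over `ℤ₂`, so the group of maps that
  KM/HKS actually apply to schemes has the same order (over a larger field the scalar triples
  `(λP, μQ, νR)`, `λμν = 1`, act identically and the map count is smaller than the tuple count).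

HONEST FRAMING: a statement about the group GENERATED by KM's/HKS's transformations over `ℤ₂`, as
the tree defines it; that this group is the whole isotropy group of `⟨n,n,n⟩` (de Groote 1978) is
not used and not typed here.

## References

* M. J. H. Heule, M. Kauers, M. Seidl, *New ways to multiply 3 × 3-matrices*, J. Symbolic Comput.
  104 (2021) 899–916, arXiv:1905.10192: §4–§5 (the group `G`, "`168³ · 6 = 28 449 792`
  elements" over `ℤ₂`). [HeuleKauersSeidl2021]
* M. Kauers, J. Moosbauer, *Flip Graphs for Matrix Multiplication*, ISSAC 2023, 381–388,
  arXiv:2212.01175: §2 (symmetry group). [KauersMoosbauer2022FlipGraphs]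
-/

set_option Elab.async false

namespace Literature.Computability.AlgebraicComplexity

open Matrix
open scoped Kronecker

namespace FlipGraph

namespace GOrder

variable {K : Type*} [Field K] {n : ℕ}

/-! ## §1 The group as a set of maps and its normal-form parametrisation -/

/-- **KM's/HKS's symmetry group `G` of `⟨n,n,n⟩` as a set of maps of the tensor space** (the
underlying maps of the tree's `InSymmetryGroup` symmetries). [cite: HeuleKauersSeidl2021, §4–§5] -/
def GMaps (K : Type*) [Field K] (n : ℕ) : Set (Tn K n → Tn K n) :=
  {f | ∃ φ : Symmetry (matMulTensor K n n n), InSymmetryGroup φ ∧ ⇑φ.toLinearEquiv = f}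

/-- The normal-form map `σ_k ∘ (P,Q,R)`. [cite: HeuleKauersSeidl2021, §4 (`G = GL(K,n)³ × S₃`)] -/
noncomputable def nfMap (k : ℕ) (P Q R : Matrix (Fin n) (Fin n) K) : Tn K n → Tn K n :=
  fun T => permMap n k (swAct P Q R T)

/-- Every normal-form map with invertible matrices is in `G`. [cite: HeuleKauersSeidl2021, §4] -/
theorem nfMap_mem {k : ℕ} {P Q R : Matrix (Fin n) (Fin n) K} (hP : IsUnit P.det)
    (hQ : IsUnit Q.det) (hR : IsUnit R.det) : nfMap k P Q R ∈ GMaps K n := by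
  refine ⟨(Symmetry.sandwich P Q R hP hQ hR).trans (permSym K n k),
    (InSymmetryGroup.sandwich P Q R hP hQ hR).trans (inSymmetryGroup_permSym k), ?_⟩
  funext T
  show (permSym K n k).toLinearEquiv ((Symmetry.sandwich P Q R hP hQ hR).toLinearEquiv T) = _
  rw [permSym_apply, sandwich_apply]
  rfl

/-- Every element of `G` is a normal-form map (the tree's normal form theorem).
[cite: HeuleKauersSeidl2021, §4] -/
theorem exists_nfMap_of_mem {f : Tn K n → Tn K n} (hf : f ∈ GMaps K n) :
    ∃ k, k < 6 ∧ ∃ P Q R : Matrix (Fin n) (Fin n) K, IsUnit P.det ∧ IsUnit Q.det ∧ IsUnit R.det ∧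
      f = nfMap k P Q R := by
  obtain ⟨φ, hφ, rfl⟩ := hf
  obtain ⟨k, hk, P, Q, R, hP, hQ, hR, h⟩ := hφ.exists_normalForm
  exact ⟨k, hk, P, Q, R, hP, hQ, hR, funext fun T => h T⟩

/-! ## §2 The normal-form maps on rank-one tensors -/

/-- Transposition of a factor (index swap; what the odd words do to factors). [cite: HeuleKauersSeidl2021, §4 (the factor `S₃` of `G`)] -/
def tp (f : Fin n × Fin n → K) : Fin n × Fin n → K := fun p => f p.swap

omit [Field K] in
/-- `tp` is an involution (bookkeeping). [folklore] -/
private theorem tp_tp (f : Fin n × Fin n → K) : tp (tp f) = f := by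
  funext p; simp [tp]

omit [Field K] in
/-- `tp` is injective (bookkeeping). [folklore] -/
private theorem tp_injective : Function.Injective (tp (K := K) (n := n)) := fun f g h => by
  rw [← tp_tp f, ← tp_tp g, h]

/-- The factors of `σ_k (z ⊗ x ⊗ y)`, slot by slot (`k < 6`; words `1, τ, ρ, τρ, ρ², τρ²`).
[cite: HeuleKauersSeidl2021, §4 (the factor `S₃`)] -/
def arrange (k : ℕ) (z x y : Fin n × Fin n → K) : Fin 3 → (Fin n × Fin n → K) :=
  match k with
  | 0 => ![z, x, y]
  | 1 => ![tp z, tp y, tp x]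
  | 2 => ![tp x, y, tp z]
  | 3 => ![x, z, tp y]
  | 4 => ![tp y, tp z, x]
  | 5 => ![y, tp x, z]
  | _ => ![z, x, y]

/-- **The words on rank-one tensors.** [cite: KauersMoosbauer2022FlipGraphs, §2 (symmetry group)] -/
theorem permMap_triad (k : ℕ) (z x y : Fin n × Fin n → K) :
    permMap n k (triad z x y) = triad (arrange k z x y 0) (arrange k z x y 1) (arrange k z x y 2) := by
  rcases k with _ | _ | _ | _ | _ | _ | _
  · rfl
  · exact transposeMap_triad z x y
  · exact cycleMap_triad z x y
  · show transposeMap n (cycleMap n (triad z x y)) = _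
    rw [cycleMap_triad, transposeMap_triad]
    show triad (tp (tp x)) (tp (tp z)) (tp y) = triad x z (tp y)
    rw [tp_tp, tp_tp]
  · show cycleMap n (cycleMap n (triad z x y)) = _
    rw [cycleMap_triad, cycleMap_triad]
    show triad (tp y) (tp z) (tp (tp x)) = triad (tp y) (tp z) x
    rw [tp_tp]
  · show transposeMap n (cycleMap n (cycleMap n (triad z x y))) = _
    rw [cycleMap_triad, cycleMap_triad, transposeMap_triad]
    show triad (tp (tp y)) (tp (tp (tp x))) (tp (tp z)) = triad y (tp x) z
    rw [tp_tp, tp_tp, tp_tp]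
  · rfl

/-- The slot to which word `k` moves the `Y`-factor. [cite: HeuleKauersSeidl2021, §4 (the factor `S₃` of `G`)] -/
def posY : ℕ → Fin 3
  | 0 => 2 | 1 => 1 | 2 => 1 | 3 => 2 | 4 => 0 | 5 => 0 | _ => 2

/-- The slot to which word `k` moves the `X`-factor. [cite: HeuleKauersSeidl2021, §4 (the factor `S₃` of `G`)] -/
def posX : ℕ → Fin 3
  | 0 => 1 | 1 => 2 | 2 => 0 | 3 => 0 | 4 => 2 | 5 => 1 | _ => 1

/-- What word `k` puts at slot `posY k`: the `Y`-factor or its transpose. [cite: HeuleKauersSeidl2021, §4 (the factor `S₃` of `G`)] -/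
def atY (k : ℕ) (y : Fin n × Fin n → K) : Fin n × Fin n → K :=
  match k with
  | 1 => tp y | 3 => tp y | 4 => tp y | _ => y

/-- What word `k` puts at slot `posX k`: the `X`-factor or its transpose. [cite: HeuleKauersSeidl2021, §4 (the factor `S₃` of `G`)] -/
def atX (k : ℕ) (x : Fin n × Fin n → K) : Fin n × Fin n → K :=
  match k with
  | 1 => tp x | 2 => tp x | 5 => tp x | _ => x

omit [Field K] in
/-- At slot `posY k` the word puts `atY k y` (bookkeeping). [folklore] -/
private theorem arrange_posY (k : ℕ) (hk : k < 6) (z x y : Fin n × Fin n → K) :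
    arrange k z x y (posY k) = atY k y := by
  revert hk
  rcases k with _ | _ | _ | _ | _ | _ | _ <;> intro hk <;> first | omega | rfl

omit [Field K] in
/-- At slot `posX k` the word puts `atX k x` (bookkeeping). [folklore] -/
private theorem arrange_posX (k : ℕ) (hk : k < 6) (z x y : Fin n × Fin n → K) :
    arrange k z x y (posX k) = atX k x := by
  revert hk
  rcases k with _ | _ | _ | _ | _ | _ | _ <;> intro hk <;> first | omega | rfl

omit [Field K] in
/-- `atY k` is injective (bookkeeping). [folklore] -/
private theorem atY_injective (k : ℕ) : Function.Injective (atY (K := K) (n := n) k) := by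
  intro y y' h
  rcases k with _ | _ | _ | _ | _ | _ | _ <;> first | exact h | exact tp_injective h

omit [Field K] in
/-- `atX k` is injective (bookkeeping). [folklore] -/
private theorem atX_injective (k : ℕ) : Function.Injective (atX (K := K) (n := n) k) := by
  intro x x' h
  rcases k with _ | _ | _ | _ | _ | _ | _ <;> first | exact h | exact tp_injective h

omit [Field K] in
/-- The other slots do not see `y` (bookkeeping). [folklore] -/
private theorem arrange_of_ne_posY (k : ℕ) (z x y y' : Fin n × Fin n → K) {i : Fin 3} (hi : i ≠ posY k) :
    arrange k z x y i = arrange k z x y' i := by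
  rcases k with _ | _ | _ | _ | _ | _ | _ <;> fin_cases i <;> simp_all [arrange, posY]

omit [Field K] in
/-- The other slots do not see `x` (bookkeeping). [folklore] -/
private theorem arrange_of_ne_posX (k : ℕ) (z x x' y : Fin n × Fin n → K) {i : Fin 3} (hi : i ≠ posX k) :
    arrange k z x y i = arrange k z x' y i := by
  rcases k with _ | _ | _ | _ | _ | _ | _ <;> fin_cases i <;> simp_all [arrange, posX]

/-- Two words with the same `X`- and `Y`-positions are equal (bookkeeping). [folklore] -/
private theorem eq_of_pos_eq {k k' : ℕ} (hk : k < 6) (hk' : k' < 6) (hX : posX k = posX k')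
    (hY : posY k = posY k') : k = k' := by
  revert hX hY
  rcases k with _ | _ | _ | _ | _ | _ | _ <;> rcases k' with _ | _ | _ | _ | _ | _ | _ <;>
    first | omega | decide

/-- **The normal-form map on a rank-one tensor:** the three Kronecker images of the factors,
arranged by the word. [cite: HeuleKauersSeidl2021, §4] -/
theorem nfMap_triad (k : ℕ) (P Q R : Matrix (Fin n) (Fin n) K) (z x y : Fin n × Fin n → K) :
    nfMap k P Q R (triad z x y) =
      triad (arrange k ((P⁻¹ᵀ ⊗ₖ R⁻¹ᵀ) *ᵥ z) ((P ⊗ₖ Q) *ᵥ x) ((Q⁻¹ᵀ ⊗ₖ R) *ᵥ y) 0)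
        (arrange k ((P⁻¹ᵀ ⊗ₖ R⁻¹ᵀ) *ᵥ z) ((P ⊗ₖ Q) *ᵥ x) ((Q⁻¹ᵀ ⊗ₖ R) *ᵥ y) 1)
        (arrange k ((P⁻¹ᵀ ⊗ₖ R⁻¹ᵀ) *ᵥ z) ((P ⊗ₖ Q) *ᵥ x) ((Q⁻¹ᵀ ⊗ₖ R) *ᵥ y) 2) := by
  show permMap n k (actTensor _ _ _ (triad z x y)) = _
  rw [actTensor_triad, permMap_triad]

/-! ## §3 Injectivity over `ℤ₂` -/

/-- A Kronecker product of invertible matrices is invertible (bookkeeping). [folklore] -/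
private theorem isUnit_kronecker {A B : Matrix (Fin n) (Fin n) K} (hA : IsUnit A.det)
    (hB : IsUnit B.det) : IsUnit (A ⊗ₖ B) := by
  rw [isUnit_iff_isUnit_det, det_kronecker]
  exact (hA.pow _).mul (hB.pow _)

/-- An invertible matrix sends non-zero vectors to non-zero vectors (bookkeeping). [folklore] -/
private theorem mulVec_ne_zero {m : Type*} [Fintype m] [DecidableEq m] {A : Matrix m m K}
    (hA : IsUnit A) {v : m → K} (hv : v ≠ 0) : A *ᵥ v ≠ 0 := by
  intro h
  apply hv
  exact mulVec_injective_iff_isUnit.mpr hA (by rw [h, mulVec_zero])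

/-- Over a field a rank-one tensor with non-zero factors is non-zero (bookkeeping). [folklore] -/
private theorem triad_ne_zero {ι κ μ : Type*} {a : ι → K} {b : κ → K} {c : μ → K} (ha : a ≠ 0)
    (hb : b ≠ 0) (hc : c ≠ 0) : triad a b c ≠ 0 := by
  obtain ⟨i, hi⟩ := Function.ne_iff.mp ha
  obtain ⟨j, hj⟩ := Function.ne_iff.mp hb
  obtain ⟨l, hl⟩ := Function.ne_iff.mp hc
  intro h
  have h' := congrFun (congrFun (congrFun h i) j) l
  simp only [triad_apply, Pi.zero_apply] at h'
  exact mul_ne_zero (mul_ne_zero hi hj) hl h'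

omit [Field K] in
/-- `tp` preserves non-vanishing (bookkeeping). [folklore] -/
private theorem tp_ne_zero [Zero K] {f : Fin n × Fin n → K} (hf : f ≠ 0) : tp f ≠ 0 := by
  intro h; apply hf; funext p
  have := congrFun h p.swap
  simpa [tp] using this

/-- Every arranged factor of non-zero factors is non-zero (bookkeeping). [folklore] -/
private theorem arrange_ne_zero (k : ℕ) {z x y : Fin n × Fin n → K} (hz : z ≠ 0) (hx : x ≠ 0)
    (hy : y ≠ 0) (i : Fin 3) : arrange k z x y i ≠ 0 := by
  rcases k with _ | _ | _ | _ | _ | _ | _ <;> fin_cases i <;>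
    simp [arrange, hz, hx, hy, tp_ne_zero]

/-- **Kronecker cancellation over `ℤ₂`:** a Kronecker product of non-zero `0/1` matrices
determines its two factors. [folklore] -/
private theorem kronecker_cancel (hK : ∀ t : K, t = 0 ∨ t = 1) {A B A' B' : Matrix (Fin n) (Fin n) K}
    (h : A ⊗ₖ B = A' ⊗ₖ B') (hA : A ≠ 0) (hB : B ≠ 0) : A = A' ∧ B = B' := by
  -- a non-zero entry of `B` is `1`
  obtain ⟨j, l, hjl⟩ : ∃ j l, B j l ≠ 0 := by
    by_contra hc; push Not at hc; exact hB (Matrix.ext fun j l => hc j l)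
  have hB1 : B j l = 1 := (hK (B j l)).resolve_left hjl
  have hent : ∀ i k j' l', A i k * B j' l' = A' i k * B' j' l' := fun i k j' l' => by
    have := congrFun (congrFun h (i, j')) (k, l')
    simpa [kronecker_apply] using this
  -- `B' j l = 1` as well, else `A = 0`
  have hB'1 : B' j l = 1 := by
    rcases hK (B' j l) with h0 | h1
    · exfalso; apply hA; ext i k
      have := hent i k j l
      rw [hB1, h0, mul_one, mul_zero] at this
      exact this
    · exact h1
  have hAA : A = A' := by
    ext i k
    have := hent i k j l
    rwa [hB1, hB'1, mul_one, mul_one] at this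
  refine ⟨hAA, ?_⟩
  -- a non-zero entry of `A` is `1`, and it is the same entry of `A'`
  obtain ⟨i, k, hik⟩ : ∃ i k, A i k ≠ 0 := by
    by_contra hc; push Not at hc; exact hA (Matrix.ext fun i k => hc i k)
  have hA1 : A i k = 1 := (hK (A i k)).resolve_left hik
  ext j' l'
  have := hent i k j' l'
  rwa [← hAA, hA1, one_mul, one_mul] at this

variable (n) in
/-- Two distinct non-zero vectors of the factor space (`n ≥ 2`). [folklore] -/
private theorem exists_pair (hn : 2 ≤ n) :
    ∃ e e' : Fin n × Fin n → K, e ≠ 0 ∧ e' ≠ 0 ∧ e ≠ e' := by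
  refine ⟨Pi.single (⟨0, by omega⟩, ⟨0, by omega⟩) 1, Pi.single (⟨1, by omega⟩, ⟨0, by omega⟩) 1,
    ?_, ?_, ?_⟩
  · intro h; have := congrFun h (⟨0, by omega⟩, ⟨0, by omega⟩); simp at this
  · intro h; have := congrFun h (⟨1, by omega⟩, ⟨0, by omega⟩); simp at this
  · intro h
    have := congrFun h (⟨0, by omega⟩, ⟨0, by omega⟩)
    simp at this

/-- **Injectivity of the normal-form parametrisation over `ℤ₂`** (`n ≥ 2`): the word and the three
matrices are determined by the map (invertibility is needed on one side only). [cite: HeuleKauersSeidl2021, §5 ("`168³ · 6`" — no coincidences)] -/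
theorem nfMap_injective (hK : ∀ t : K, t = 0 ∨ t = 1) (hn : 2 ≤ n) {k k' : ℕ} (hk : k < 6)
    (hk' : k' < 6) {P Q R P' Q' R' : Matrix (Fin n) (Fin n) K} (hP : IsUnit P.det)
    (hQ : IsUnit Q.det) (hR : IsUnit R.det) (h : nfMap k P Q R = nfMap k' P' Q' R') :
    k = k' ∧ P = P' ∧ Q = Q' ∧ R = R' := by
  classical
  -- the six Kronecker matrices are invertible
  have hT : ∀ {M : Matrix (Fin n) (Fin n) K}, IsUnit M.det → IsUnit M⁻¹ᵀ.det := fun hM => by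
    rw [det_transpose]; exact isUnit_nonsing_inv_det _ hM
  have uA := isUnit_kronecker (hT hP) (hT hR)
  have uB := isUnit_kronecker hP hQ
  have uC := isUnit_kronecker (hT hQ) hR
  obtain ⟨e, e', he, he', hee'⟩ := exists_pair (K := K) n hn
  -- slotwise equality of the images of `z ⊗ x ⊗ y` for non-zero factors
  have slots : ∀ (z x y : Fin n × Fin n → K), z ≠ 0 → x ≠ 0 → y ≠ 0 → ∀ i : Fin 3,
      arrange k ((P⁻¹ᵀ ⊗ₖ R⁻¹ᵀ) *ᵥ z) ((P ⊗ₖ Q) *ᵥ x) ((Q⁻¹ᵀ ⊗ₖ R) *ᵥ y) i =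
        arrange k' ((P'⁻¹ᵀ ⊗ₖ R'⁻¹ᵀ) *ᵥ z) ((P' ⊗ₖ Q') *ᵥ x) ((Q'⁻¹ᵀ ⊗ₖ R') *ᵥ y) i := by
    intro z x y hz hx hy
    have hzz := mulVec_ne_zero uA hz
    have hxx := mulVec_ne_zero uB hx
    have hyy := mulVec_ne_zero uC hy
    have heq := congrFun h (triad z x y)
    rw [nfMap_triad, nfMap_triad] at heq
    have h0 := triad_ne_zero (arrange_ne_zero k hzz hxx hyy 0) (arrange_ne_zero k hzz hxx hyy 1)
      (arrange_ne_zero k hzz hxx hyy 2)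
    obtain ⟨h₀, h₁, h₂⟩ := triad_factors_eq_of_two hK heq h0
    intro i; fin_cases i
    · exact h₀
    · exact h₁
    · exact h₂
  -- Step 1: the `Y`-positions agree
  have hY : posY k = posY k' := by
    by_contra hne
    have s1 := slots e e e he he he (posY k)
    have s2 := slots e e e' he he he' (posY k)
    rw [← arrange_of_ne_posY k' _ _ ((Q'⁻¹ᵀ ⊗ₖ R') *ᵥ e) ((Q'⁻¹ᵀ ⊗ₖ R') *ᵥ e') hne, ← s1,
      arrange_posY k hk, arrange_posY k hk] at s2
    -- so slot `posY k` of word `k` does not see `y` either: `C e = C e'`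
    exact hee' (mulVec_injective_iff_isUnit.mpr uC (atY_injective k s2.symm))
  -- Step 2: the `X`-positions agree
  have hX : posX k = posX k' := by
    by_contra hne
    have s1 := slots e e e he he he (posX k)
    have s2 := slots e e' e he he' he (posX k)
    rw [← arrange_of_ne_posX k' _ ((P' ⊗ₖ Q') *ᵥ e) ((P' ⊗ₖ Q') *ᵥ e') _ hne, ← s1,
      arrange_posX k hk, arrange_posX k hk] at s2
    exact hee' (mulVec_injective_iff_isUnit.mpr uB (atX_injective k s2.symm))
  have hkk : k = k' := eq_of_pos_eq hk hk' hX hY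
  subst hkk
  refine ⟨rfl, ?_⟩
  -- Step 3: with the same word, the sandwich maps agree slot by slot
  have hB : P ⊗ₖ Q = P' ⊗ₖ Q' := by
    rw [ext_iff_mulVec]
    intro x
    by_cases hx : x = 0
    · rw [hx, mulVec_zero, mulVec_zero]
    have s := slots e x e he hx he (posX k)
    rw [arrange_posX k hk, arrange_posX k hk] at s
    exact atX_injective k s
  have hC : Q⁻¹ᵀ ⊗ₖ R = Q'⁻¹ᵀ ⊗ₖ R' := by
    rw [ext_iff_mulVec]
    intro y
    by_cases hy : y = 0
    · rw [hy, mulVec_zero, mulVec_zero]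
    have s := slots e e y he he hy (posY k)
    rw [arrange_posY k hk, arrange_posY k hk] at s
    exact atY_injective k s
  -- Step 4: Kronecker cancellation over `ℤ₂`
  have hne : Nonempty (Fin n) := ⟨⟨0, by omega⟩⟩
  have nz : ∀ {M : Matrix (Fin n) (Fin n) K}, IsUnit M.det → M ≠ 0 := fun hM h0 => by
    rw [h0, det_zero] at hM; exact not_isUnit_zero hM
  have nzP : P ≠ 0 := nz hP
  have nzQ : Q ≠ 0 := nz hQ
  have nzR : R ≠ 0 := nz hR
  have nzQt : Q⁻¹ᵀ ≠ 0 := nz (hT hQ)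
  obtain ⟨hPP, hQQ⟩ := kronecker_cancel hK hB nzP nzQ
  obtain ⟨_, hRR⟩ := kronecker_cancel hK hC nzQt nzR
  exact ⟨hPP, hQQ, hRR⟩

/-! ## §4 The count -/

/-- The parametrisation by `Fin 6 × GL_n³`. [cite: HeuleKauersSeidl2021, §4] -/
noncomputable def param (c : Fin 6 × GL (Fin n) K × GL (Fin n) K × GL (Fin n) K) : GMaps K n :=
  ⟨nfMap c.1.val (c.2.1 : Matrix (Fin n) (Fin n) K) (c.2.2.1 : Matrix (Fin n) (Fin n) K)
      (c.2.2.2 : Matrix (Fin n) (Fin n) K),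
    nfMap_mem ((isUnit_iff_isUnit_det _).mp c.2.1.isUnit)
      ((isUnit_iff_isUnit_det _).mp c.2.2.1.isUnit) ((isUnit_iff_isUnit_det _).mp c.2.2.2.isUnit)⟩

/-- It is onto. [cite: HeuleKauersSeidl2021, §4] -/
theorem param_surjective : Function.Surjective (param (K := K) (n := n)) := by
  rintro ⟨f, hf⟩
  obtain ⟨k, hk, P, Q, R, hP, hQ, hR, rfl⟩ := exists_nfMap_of_mem hf
  refine ⟨(⟨k, hk⟩, ((isUnit_iff_isUnit_det P).mpr hP).unit, ((isUnit_iff_isUnit_det Q).mpr hQ).unit,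
    ((isUnit_iff_isUnit_det R).mpr hR).unit), ?_⟩
  apply Subtype.ext
  simp only [param, IsUnit.unit_spec]

/-- Over `ℤ₂` (`n ≥ 2`) it is one-to-one. [cite: HeuleKauersSeidl2021, §5] -/
theorem param_injective (hK : ∀ t : K, t = 0 ∨ t = 1) (hn : 2 ≤ n) :
    Function.Injective (param (K := K) (n := n)) := by
  rintro ⟨k, g₁, g₂, g₃⟩ ⟨k', g₁', g₂', g₃'⟩ h
  have h' := congrArg Subtype.val h
  simp only [param] at h'
  obtain ⟨hk, h₁, h₂, h₃⟩ := nfMap_injective hK hn k.isLt k'.isLt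
    ((isUnit_iff_isUnit_det _).mp g₁.isUnit) ((isUnit_iff_isUnit_det _).mp g₂.isUnit)
    ((isUnit_iff_isUnit_det _).mp g₃.isUnit) h'
  have e₁ : g₁ = g₁' := Units.ext h₁
  have e₂ : g₂ = g₂' := Units.ext h₂
  have e₃ : g₃ = g₃' := Units.ext h₃
  subst e₁; subst e₂; subst e₃
  simp only [Prod.mk.injEq, and_true]
  exact Fin.ext hk

/-- **`|G| = 6 · |GL_n|³` over `ℤ₂`** (`n ≥ 2`), counting `G` as maps of the tensor space.
[cite: HeuleKauersSeidl2021, §5] -/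
theorem card_GMaps (hK : ∀ t : K, t = 0 ∨ t = 1) (hn : 2 ≤ n) :
    Nat.card (GMaps K n) = 6 * Nat.card (GL (Fin n) K) ^ 3 := by
  rw [← Nat.card_congr (Equiv.ofBijective _ ⟨param_injective hK hn, param_surjective⟩),
    Nat.card_prod, Nat.card_prod, Nat.card_prod, Nat.card_eq_fintype_card (α := Fin 6),
    Fintype.card_fin]
  ring

/-- The two scalars of `ℤ₂` (bookkeeping). [folklore] -/
private theorem zmod_two_cases : ∀ t : ZMod 2, t = 0 ∨ t = 1 := by decide

/-- **HKS §5: "even for `K = ℤ₂`, the group `G` has `168³ · 6 = 28 449 792` elements"** — kernel,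
for the tree's `G` of `⟨3,3,3⟩` over `ℤ₂` counted as maps. [cite: HeuleKauersSeidl2021, §5] -/
theorem heuleKauersSeidl2021_card_G_333 : Nat.card (GMaps (ZMod 2) 3) = 28449792 := by
  rw [card_GMaps zmod_two_cases (by norm_num), card_GL_fin_three_zmod_two]
  norm_num

/-- **Bridge to the tree's set-level count** (`SchemeSymmetryGroupOrderF2.lean`,
`heuleKauersSeidl2021_symmetry_group_card`): over `ℤ₂` the group of MAPS `G` of `⟨3,3,3⟩` has
exactly as many elements as the set `GL₃(ℤ₂)³ × S₃` of tuples — the action is faithful.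
[cite: HeuleKauersSeidl2021, §4–§5 (`G = GL(K,3)³ × S₃`; "`168³ · 6 = 28 449 792` elements")] -/
theorem card_GMaps_three_eq_card_tuples :
    Nat.card (GMaps (ZMod 2) 3) =
      Nat.card ((GL (Fin 3) (ZMod 2) × GL (Fin 3) (ZMod 2) × GL (Fin 3) (ZMod 2)) ×
        Equiv.Perm (Fin 3)) := by
  rw [heuleKauersSeidl2021_card_G_333, heuleKauersSeidl2021_symmetry_group_card]

/-- The `n = 2` instance of HKS's count: for `⟨2,2,2⟩` over `ℤ₂`, `|G| = 6³ · 6 = 1296` (the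
order of the group whose orbits are the vertices of KM's Fig. 1; KM do not print this number — it
is the same formula `6 · |GL_n(ℤ₂)|³`). [cite: HeuleKauersSeidl2021, §5 (the count `|GL_n(ℤ₂)|³ · 6`, printed for `n = 3`)] -/
theorem card_G_222 : Nat.card (GMaps (ZMod 2) 2) = 1296 := by
  rw [card_GMaps zmod_two_cases (by norm_num), card_GL_fin_two_zmod_two]
  norm_num

end GOrder

end FlipGraph

end Literature.Computability.AlgebraicComplexity
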